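import Literature.MathematicalPhysics.StatisticalMechanics.HaggStacking

/-!
# «RunCut» S2, word level (lens-4, g85): the class calculus of the TRIPLE slip

The competitor of memo `g85/memo/SW-S3.md` §3 moves, on a cubic run around layer `j` (letters `c` on layers `j−2 … j+2`, i.e. SIX EQUAL Hägg steps
`s(j−3) = ⋯ = s(j+2)`), the layers `j−1, j` by one Shockley class and the layer `j+1` by the other; on the Hägg word this REVERSES the three steps
`j−2, j, j+1` (`tripleFlip`).  This file proves the word-level bookkeeping the per-column energy identity consumes:

* `haggWindow_tripleFlip` — closed form of every window sum of the slipped word;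
* `haggAligned_tripleFlip_iff` — a pair of layers `(m, m+k)` can change alignment only for the SIX starts `m ∈ {j−1−k, j−k, j+1−k, j−1, j, j+1}`;
* `sum_delta_two` — at distance `k = 2` EXACTLY FOUR pairs become aligned (the four new h-letters): `∑_m Δ_m(2) = 4·J₂`;
* `abs_sum_delta_le` — at every distance `k ≥ 2`, `|∑_m Δ_m(k)| ≤ 6·|J_k|`;
* `swap_localEnergyTrunc_le` (§5) — the same for the tree's SWAP (steps `j−1, j, j+1` reversed): `≤ 2·J₂ + 4·∑_{3 ≤ k ≤ K} |J_k|`, the shape of `IdealTwinGain`;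
* `triple_localEnergyTrunc_le` — ★ `∑_m [E_K(slipped)(m) − E_K(m)] ≤ 4·J₂ + 6·∑_{3 ≤ k ≤ K} |J_k|` for the range-`K` local stacking energies of
  `Literature…HaggStacking` (any coupling sequence `J`, any `K ≥ 2`, any column window `|m − j| ≤ M`, `M ≥ 3`).

With `J_k = barlowCoupling lennardJones a (a√(2/3)) k` this is the input of `…TwinGainWide.tripleGain_margin_wide` (`4J₂ + 6∑|J_k| ≤ −1/250000`).
[this file: 7 small definitions (`flipOne`, `tripleFlip`, `critical`, `delta`, `swapFlip`, `swapCritical`, `swapDelta`), 0 sorry.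
Remark: a local slip of finitely many layers changes steps by amounts summing to `0 mod 3`, so in a cubic run every registry-preserving local move
reverses a multiple of THREE steps — SWAP and TRIPLE are the two cheapest.]
-/

noncomputable section

namespace Summit.AtomisticToContinuum.Crystallization.Theorems.OverbindingBudgetAffineRunCutWord

open Finset
open Literature.MathematicalPhysics.StatisticalMechanics

variable {s : ℤ → ℤ} {j : ℤ}

/-! ## §1  The slipped word -/

/-- The word with the single step `f` reversed. -/
def flipOne (f : ℤ) (s : ℤ → ℤ) : ℤ → ℤ := fun i => if i = f then -s i else s i

/-- **The TRIPLE-slipped word**: steps `j − 2`, `j`, `j + 1` reversed (layers `j−1, j` moved by one Shockley class, layer `j+1` by the other). -/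
def tripleFlip (j : ℤ) (s : ℤ → ℤ) : ℤ → ℤ := fun i => if i = j - 2 ∨ i = j ∨ i = j + 1 then -s i else s i

/-- The six window starts at which a pair at distance `k` can change alignment. -/
def critical (j : ℤ) (k : ℕ) : Finset ℤ := {j - 1 - k, j - k, j + 1 - k, j - 1, j, j + 1}

/-- The change of the `k`-th local energy term at layer `m` under the slip. -/
def delta (J : ℕ → ℝ) (j : ℤ) (s : ℤ → ℤ) (m : ℤ) (k : ℕ) : ℝ :=
  (if HaggAligned (tripleFlip j s) m k then J k else 0) - (if HaggAligned s m k then J k else 0)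

/-- `tripleFlip_eq` (docstring added by the landing lane; see the module docstring). [formal bookkeeping] -/
theorem tripleFlip_eq (j : ℤ) (s : ℤ → ℤ) : tripleFlip j s = flipOne (j - 2) (flipOne j (flipOne (j + 1) s)) := by
  funext i
  simp only [tripleFlip, flipOne]
  split_ifs <;> first | rfl | omega

/-- The slipped word is a Hägg word. -/
theorem isHaggSeq_tripleFlip (hs : IsHaggSeq s) (j : ℤ) : IsHaggSeq (tripleFlip j s) := by
  intro i
  simp only [tripleFlip]
  rcases hs i with h | h <;> split_ifs <;> omega

/-! ## §2  Window sums of the slipped word -/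

/-- Reversing one step changes a window sum by `−2·s f` iff the step lies in the window. -/
theorem haggWindow_flipOne (f : ℤ) (s : ℤ → ℤ) (m : ℤ) (k : ℕ) :
    haggWindow (flipOne f s) m k = haggWindow s m k - (if m ≤ f ∧ f < m + k then 2 * s f else 0) := by
  induction k with
  | zero =>
      have h : ¬ (m ≤ f ∧ f < m + ((0 : ℕ) : ℤ)) := by push_cast; omega
      rw [haggWindow_zero, haggWindow_zero, if_neg h, sub_zero]
  | succ n ih =>
      rw [haggWindow_succ, haggWindow_succ, ih]
      push_cast
      by_cases hf : m + (n : ℤ) = f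
      · have e0 : flipOne f s (m + n) = -s f := by simp [flipOne, hf]
        have e1 : ¬ (m ≤ f ∧ f < m + (n : ℤ)) := by omega
        have e2 : (m ≤ f ∧ f < m + ((n : ℤ) + 1)) := by omega
        rw [e0, if_neg e1, if_pos e2, ← hf]
        ring
      · have e0 : flipOne f s (m + n) = s (m + n) := by simp [flipOne, hf]
        rw [e0]
        by_cases hin : m ≤ f ∧ f < m + (n : ℤ)
        · have hin' : m ≤ f ∧ f < m + ((n : ℤ) + 1) := ⟨hin.1, by omega⟩
          rw [if_pos hin, if_pos hin']
          ring
        · have hin' : ¬ (m ≤ f ∧ f < m + ((n : ℤ) + 1)) := by omega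
          rw [if_neg hin, if_neg hin']
          ring

/-- **Closed form of the slipped windows.** -/
theorem haggWindow_tripleFlip (j : ℤ) (s : ℤ → ℤ) (m : ℤ) (k : ℕ) :
    haggWindow (tripleFlip j s) m k = haggWindow s m k
      - (if m ≤ j + 1 ∧ j + 1 < m + k then 2 * s (j + 1) else 0) - (if m ≤ j ∧ j < m + k then 2 * s j else 0)
      - (if m ≤ j - 2 ∧ j - 2 < m + k then 2 * s (j - 2) else 0) := by
  rw [tripleFlip_eq, haggWindow_flipOne, haggWindow_flipOne, haggWindow_flipOne]
  have h1 : flipOne j (flipOne (j + 1) s) (j - 2) = s (j - 2) := by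
    simp [flipOne, show j - 2 ≠ j by omega, show j - 2 ≠ j + 1 by omega]
  have h2 : flipOne (j + 1) s j = s j := by
    simp [flipOne, show j ≠ j + 1 by omega]
  rw [h1, h2]

/-- `haggWindow s m 2 = s m + s (m+1)`.  (Landing lane, hand-2 g40: made `private` — dedup token; the statement restates TREE
`…ChargedEnergyGapChartDial.haggWindow_two` of `…ChargedEnergyGapStackingClassA`, which this module does not import.) -/
private theorem haggWindow_two (s : ℤ → ℤ) (m : ℤ) : haggWindow s m 2 = s m + s (m + 1) := by
  simp [haggWindow, Finset.sum_range_succ]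

/-! ## §3  Which pairs change alignment -/

/-- **Off the six critical starts, alignment at distance `k ≥ 2` is unchanged** (the window then contains none or all of the three reversed steps,
and `s(j−2) = s j = s(j+1)` makes the total correction `0` or `∓6`). -/
theorem haggAligned_tripleFlip_iff (hrun : s (j - 2) = s j ∧ s j = s (j + 1)) {m : ℤ} {k : ℕ} (hk : 2 ≤ k)
    (hm : m ∉ critical j k) : HaggAligned (tripleFlip j s) m k ↔ HaggAligned s m k := by
  simp only [critical, Finset.mem_insert, Finset.mem_singleton, not_or] at hm
  obtain ⟨h1, h2, h3, h4, h5, h6⟩ := hm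
  obtain ⟨hr1, hr2⟩ := hrun
  have hk' : (2 : ℤ) ≤ (k : ℤ) := by exact_mod_cast hk
  show haggWindow (tripleFlip j s) m k % 3 = 0 ↔ haggWindow s m k % 3 = 0
  rw [haggWindow_tripleFlip]
  split_ifs <;> omega

/-- `delta_eq_zero` (docstring added by the landing lane; see the module docstring). [formal bookkeeping] -/
theorem delta_eq_zero {J : ℕ → ℝ} (hrun : s (j - 2) = s j ∧ s j = s (j + 1)) {m : ℤ} {k : ℕ} (hk : 2 ≤ k)
    (hm : m ∉ critical j k) : delta J j s m k = 0 := by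
  simp [delta, haggAligned_tripleFlip_iff hrun hk hm]

/-- `abs_delta_le` (docstring added by the landing lane; see the module docstring). [formal bookkeeping] -/
theorem abs_delta_le (J : ℕ → ℝ) (j : ℤ) (s : ℤ → ℤ) (m : ℤ) (k : ℕ) : |delta J j s m k| ≤ |J k| := by
  unfold delta
  split_ifs <;> simp

/-- **At every distance `k ≥ 2`: `|∑_m Δ_m(k)| ≤ 6·|J_k|`** (any finite set of starts). -/
theorem abs_sum_delta_le {J : ℕ → ℝ} (hrun : s (j - 2) = s j ∧ s j = s (j + 1)) {k : ℕ} (hk : 2 ≤ k) (I : Finset ℤ) :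
    |∑ m ∈ I, delta J j s m k| ≤ 6 * |J k| := by
  rw [← Finset.sum_filter_of_ne (p := fun m => m ∈ critical j k)
    (fun m _ hne => by by_contra h; exact hne (delta_eq_zero hrun hk h))]
  have hc : ((I.filter fun m => m ∈ critical j k).card : ℝ) ≤ 6 := by
    have h₁ : (I.filter fun m => m ∈ critical j k).card ≤ (critical j k).card :=
      Finset.card_le_card fun x hx => (Finset.mem_filter.1 hx).2
    have h₂ : (critical j k).card ≤ 6 := Finset.card_le_six
    exact_mod_cast h₁.trans h₂
  calc |∑ m ∈ I.filter (fun m => m ∈ critical j k), delta J j s m k|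
      ≤ ∑ m ∈ I.filter (fun m => m ∈ critical j k), |delta J j s m k| := Finset.abs_sum_le_sum_abs _ _
    _ ≤ ∑ m ∈ I.filter (fun m => m ∈ critical j k), |J k| := Finset.sum_le_sum fun m _ => abs_delta_le J j s m k
    _ = ((I.filter fun m => m ∈ critical j k).card : ℝ) * |J k| := by rw [Finset.sum_const, nsmul_eq_mul]
    _ ≤ 6 * |J k| := mul_le_mul_of_nonneg_right hc (abs_nonneg _)

/-- **At distance `2`, exactly the four starts `j−3, j−2, j−1, j+1` become aligned** (the four new h-letters); needs the six equal steps of the run. -/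
theorem delta_two_eq (hs : IsHaggSeq s)
    (hrun6 : s (j - 3) = s (j - 2) ∧ s (j - 2) = s (j - 1) ∧ s (j - 1) = s j ∧ s j = s (j + 1) ∧ s (j + 1) = s (j + 2))
    (J : ℕ → ℝ) (m : ℤ) :
    delta J j s m 2 = if m ∈ ({j - 3, j - 2, j - 1, j + 1} : Finset ℤ) then J 2 else 0 := by
  obtain ⟨e1, e2, e3, e4, e5⟩ := hrun6
  have g3 := hs (j - 3)
  have g0 := hs j
  have gm := hs m
  have gm1 := hs (m + 1)
  simp only [Finset.mem_insert, Finset.mem_singleton]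
  unfold delta
  simp only [HaggAligned, haggWindow_two, tripleFlip]
  by_cases h3 : m = j - 3
  · have t1 : s m = s (j - 3) := by rw [h3]
    have t2 : s (m + 1) = s (j - 2) := by rw [show m + 1 = j - 2 by omega]
    split_ifs <;> first | (exfalso; omega) | ring
  by_cases h2 : m = j - 2
  · have t1 : s m = s (j - 2) := by rw [h2]
    have t2 : s (m + 1) = s (j - 1) := by rw [show m + 1 = j - 1 by omega]
    split_ifs <;> first | (exfalso; omega) | ring
  by_cases h1 : m = j - 1
  · have t1 : s m = s (j - 1) := by rw [h1]
    have t2 : s (m + 1) = s j := by rw [show m + 1 = j by omega]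
    split_ifs <;> first | (exfalso; omega) | ring
  by_cases h0 : m = j
  · have t1 : s m = s j := by rw [h0]
    have t2 : s (m + 1) = s (j + 1) := by rw [show m + 1 = j + 1 by omega]
    split_ifs <;> first | (exfalso; omega) | ring
  by_cases h1' : m = j + 1
  · have t1 : s m = s (j + 1) := by rw [h1']
    have t2 : s (m + 1) = s (j + 2) := by rw [show m + 1 = j + 2 by omega]
    split_ifs <;> first | (exfalso; omega) | ring
  split_ifs <;> first | (exfalso; omega) | ring

/-- `sum_delta_two` (docstring added by the landing lane; see the module docstring). [formal bookkeeping] -/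
theorem sum_delta_two (hs : IsHaggSeq s)
    (hrun6 : s (j - 3) = s (j - 2) ∧ s (j - 2) = s (j - 1) ∧ s (j - 1) = s j ∧ s j = s (j + 1) ∧ s (j + 1) = s (j + 2))
    (J : ℕ → ℝ) {M : ℕ} (hM : 3 ≤ M) :
    ∑ m ∈ Finset.Icc (j - M) (j + M), delta J j s m 2 = 4 * J 2 := by
  rw [Finset.sum_congr rfl fun m _ => delta_two_eq hs hrun6 J m, Finset.sum_ite_mem]
  have hM' : (3 : ℤ) ≤ (M : ℤ) := by exact_mod_cast hM
  have hsub : ({j - 3, j - 2, j - 1, j + 1} : Finset ℤ) ⊆ Finset.Icc (j - M) (j + M) := by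
    intro x hx
    simp only [Finset.mem_insert, Finset.mem_singleton] at hx
    simp only [Finset.mem_Icc]
    omega
  rw [Finset.inter_eq_right.2 hsub, Finset.sum_insert, Finset.sum_insert, Finset.sum_insert, Finset.sum_singleton]
  · ring
  all_goals simp only [Finset.mem_insert, Finset.mem_singleton]; omega

/-! ## §4  The column inequality -/

/-- ★ **THE TRIPLE COLUMN INEQUALITY (word level)**: for a Hägg word with six equal steps `s(j−3) = ⋯ = s(j+2)` (letters `c` on layers `j−2 … j+2`),
every coupling sequence `J`, range `K ≥ 2` and column window `M ≥ 3`,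
`∑_{|m−j| ≤ M} [E_K(tripleFlip j s)(m) − E_K(s)(m)] ≤ 4·J 2 + 6·∑_{k=3}^{K} |J k|`. [this file · kind: proof] -/
theorem triple_localEnergyTrunc_le (hs : IsHaggSeq s)
    (hrun6 : s (j - 3) = s (j - 2) ∧ s (j - 2) = s (j - 1) ∧ s (j - 1) = s j ∧ s j = s (j + 1) ∧ s (j + 1) = s (j + 2))
    (J : ℕ → ℝ) {K M : ℕ} (hK : 2 ≤ K) (hM : 3 ≤ M) :
    ∑ m ∈ Finset.Icc (j - M) (j + M), (haggLocalEnergyTrunc K J (tripleFlip j s) m - haggLocalEnergyTrunc K J s m)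
      ≤ 4 * J 2 + 6 * ∑ k ∈ Finset.Icc 3 K, |J k| := by
  have hrun : s (j - 2) = s j ∧ s j = s (j + 1) := ⟨by omega, by omega⟩
  have e1 : ∀ m, haggLocalEnergyTrunc K J (tripleFlip j s) m - haggLocalEnergyTrunc K J s m
      = ∑ k ∈ Finset.Icc 2 K, delta J j s m k := by
    intro m
    simp only [haggLocalEnergyTrunc, delta, Finset.sum_sub_distrib]
  rw [Finset.sum_congr rfl fun m _ => e1 m, Finset.sum_comm]
  have hI : Finset.Icc 2 K = insert 2 (Finset.Icc 3 K) := by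
    ext k
    simp only [Finset.mem_Icc, Finset.mem_insert]
    omega
  rw [hI, Finset.sum_insert (by simp), sum_delta_two hs hrun6 J hM, Finset.mul_sum]
  have hsum : ∑ k ∈ Finset.Icc 3 K, ∑ m ∈ Finset.Icc (j - M) (j + M), delta J j s m k
      ≤ ∑ k ∈ Finset.Icc 3 K, 6 * |J k| :=
    Finset.sum_le_sum fun k hk => by
      have hk3 : 3 ≤ k := (Finset.mem_Icc.1 hk).1
      exact (le_abs_self _).trans (abs_sum_delta_le hrun (by omega) _)
  linarith [hsum]

/-! ## §5  The SWAP (micro-twin) slip: steps `j−1, j, j+1` reversed, two new h-letters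

The tree's documented competitor (RunCutA header: one interior layer pair, layers `j ↦ +b`, `j+1 ↦ −b`) reverses the three CONSECUTIVE steps
`j−1, j, j+1`; only FOUR starts are critical, `ϑ₂ = 2`, `|ϑ_k| ≤ 4` — the shape of `IdealTwinGain` (`2J₂ + 4∑|J_k|`). -/

/-- **The SWAP-slipped word**: steps `j − 1`, `j`, `j + 1` reversed. -/
def swapFlip (j : ℤ) (s : ℤ → ℤ) : ℤ → ℤ := fun i => if i = j - 1 ∨ i = j ∨ i = j + 1 then -s i else s i

/-- The four critical window starts of the SWAP at distance `k`. -/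
def swapCritical (j : ℤ) (k : ℕ) : Finset ℤ := {j - k, j + 1 - k, j, j + 1}

/-- The change of the `k`-th local energy term at layer `m` under the SWAP. -/
def swapDelta (J : ℕ → ℝ) (j : ℤ) (s : ℤ → ℤ) (m : ℤ) (k : ℕ) : ℝ :=
  (if HaggAligned (swapFlip j s) m k then J k else 0) - (if HaggAligned s m k then J k else 0)

/-- `swapFlip_eq` (docstring added by the landing lane; see the module docstring). [formal bookkeeping] -/
theorem swapFlip_eq (j : ℤ) (s : ℤ → ℤ) : swapFlip j s = flipOne (j - 1) (flipOne j (flipOne (j + 1) s)) := by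
  funext i
  simp only [swapFlip, flipOne]
  split_ifs <;> first | rfl | omega

/-- The SWAP-slipped word is a Hägg word. -/
theorem isHaggSeq_swapFlip (hs : IsHaggSeq s) (j : ℤ) : IsHaggSeq (swapFlip j s) := by
  intro i
  simp only [swapFlip]
  rcases hs i with h | h <;> split_ifs <;> omega

/-- Closed form of the SWAP windows. -/
theorem haggWindow_swapFlip (j : ℤ) (s : ℤ → ℤ) (m : ℤ) (k : ℕ) :
    haggWindow (swapFlip j s) m k = haggWindow s m k
      - (if m ≤ j + 1 ∧ j + 1 < m + k then 2 * s (j + 1) else 0) - (if m ≤ j ∧ j < m + k then 2 * s j else 0)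
      - (if m ≤ j - 1 ∧ j - 1 < m + k then 2 * s (j - 1) else 0) := by
  rw [swapFlip_eq, haggWindow_flipOne, haggWindow_flipOne, haggWindow_flipOne]
  have h1 : flipOne j (flipOne (j + 1) s) (j - 1) = s (j - 1) := by
    simp [flipOne, show j - 1 ≠ j by omega, show j - 1 ≠ j + 1 by omega]
  have h2 : flipOne (j + 1) s j = s j := by
    simp [flipOne, show j ≠ j + 1 by omega]
  rw [h1, h2]

/-- Off the four critical starts, alignment at distance `k ≥ 2` is unchanged under the SWAP (run hypothesis `s(j−1) = s j = s(j+1)`). -/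
theorem haggAligned_swapFlip_iff (hrun : s (j - 1) = s j ∧ s j = s (j + 1)) {m : ℤ} {k : ℕ} (hk : 2 ≤ k)
    (hm : m ∉ swapCritical j k) : HaggAligned (swapFlip j s) m k ↔ HaggAligned s m k := by
  simp only [swapCritical, Finset.mem_insert, Finset.mem_singleton, not_or] at hm
  obtain ⟨h1, h2, h3, h4⟩ := hm
  obtain ⟨hr1, hr2⟩ := hrun
  have hk' : (2 : ℤ) ≤ (k : ℤ) := by exact_mod_cast hk
  show haggWindow (swapFlip j s) m k % 3 = 0 ↔ haggWindow s m k % 3 = 0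
  rw [haggWindow_swapFlip]
  split_ifs <;> omega

/-- `swapDelta_eq_zero` (docstring added by the landing lane; see the module docstring). [formal bookkeeping] -/
theorem swapDelta_eq_zero {J : ℕ → ℝ} (hrun : s (j - 1) = s j ∧ s j = s (j + 1)) {m : ℤ} {k : ℕ} (hk : 2 ≤ k)
    (hm : m ∉ swapCritical j k) : swapDelta J j s m k = 0 := by
  simp [swapDelta, haggAligned_swapFlip_iff hrun hk hm]

/-- `abs_swapDelta_le` (docstring added by the landing lane; see the module docstring). [formal bookkeeping] -/
theorem abs_swapDelta_le (J : ℕ → ℝ) (j : ℤ) (s : ℤ → ℤ) (m : ℤ) (k : ℕ) : |swapDelta J j s m k| ≤ |J k| := by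
  unfold swapDelta
  split_ifs <;> simp

/-- **At every distance `k ≥ 2`: `|∑_m Δ_m(k)| ≤ 4·|J_k|` under the SWAP.** -/
theorem abs_sum_swapDelta_le {J : ℕ → ℝ} (hrun : s (j - 1) = s j ∧ s j = s (j + 1)) {k : ℕ} (hk : 2 ≤ k) (I : Finset ℤ) :
    |∑ m ∈ I, swapDelta J j s m k| ≤ 4 * |J k| := by
  rw [← Finset.sum_filter_of_ne (p := fun m => m ∈ swapCritical j k)
    (fun m _ hne => by by_contra h; exact hne (swapDelta_eq_zero hrun hk h))]
  have hc : ((I.filter fun m => m ∈ swapCritical j k).card : ℝ) ≤ 4 := by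
    have h₁ : (I.filter fun m => m ∈ swapCritical j k).card ≤ (swapCritical j k).card :=
      Finset.card_le_card fun x hx => (Finset.mem_filter.1 hx).2
    have h₂ : (swapCritical j k).card ≤ 4 := Finset.card_le_four
    exact_mod_cast h₁.trans h₂
  calc |∑ m ∈ I.filter (fun m => m ∈ swapCritical j k), swapDelta J j s m k|
      ≤ ∑ m ∈ I.filter (fun m => m ∈ swapCritical j k), |swapDelta J j s m k| := Finset.abs_sum_le_sum_abs _ _
    _ ≤ ∑ m ∈ I.filter (fun m => m ∈ swapCritical j k), |J k| := Finset.sum_le_sum fun m _ => abs_swapDelta_le J j s m k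
    _ = ((I.filter fun m => m ∈ swapCritical j k).card : ℝ) * |J k| := by rw [Finset.sum_const, nsmul_eq_mul]
    _ ≤ 4 * |J k| := mul_le_mul_of_nonneg_right hc (abs_nonneg _)

/-- At distance `2` under the SWAP exactly the two starts `j−2, j+1` become aligned (the two new h-letters); needs the five equal steps
`s(j−2) = ⋯ = s(j+2)`. -/
theorem swapDelta_two_eq (hs : IsHaggSeq s)
    (hrun5 : s (j - 2) = s (j - 1) ∧ s (j - 1) = s j ∧ s j = s (j + 1) ∧ s (j + 1) = s (j + 2)) (J : ℕ → ℝ) (m : ℤ) :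
    swapDelta J j s m 2 = if m ∈ ({j - 2, j + 1} : Finset ℤ) then J 2 else 0 := by
  obtain ⟨e2, e3, e4, e5⟩ := hrun5
  have g0 := hs j
  have gm := hs m
  have gm1 := hs (m + 1)
  simp only [Finset.mem_insert, Finset.mem_singleton]
  unfold swapDelta
  simp only [HaggAligned, haggWindow_two, swapFlip]
  by_cases h2 : m = j - 2
  · have t1 : s m = s (j - 2) := by rw [h2]
    have t2 : s (m + 1) = s (j - 1) := by rw [show m + 1 = j - 1 by omega]
    split_ifs <;> first | (exfalso; omega) | ring
  by_cases h1 : m = j - 1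
  · have t1 : s m = s (j - 1) := by rw [h1]
    have t2 : s (m + 1) = s j := by rw [show m + 1 = j by omega]
    split_ifs <;> first | (exfalso; omega) | ring
  by_cases h0 : m = j
  · have t1 : s m = s j := by rw [h0]
    have t2 : s (m + 1) = s (j + 1) := by rw [show m + 1 = j + 1 by omega]
    split_ifs <;> first | (exfalso; omega) | ring
  by_cases h1' : m = j + 1
  · have t1 : s m = s (j + 1) := by rw [h1']
    have t2 : s (m + 1) = s (j + 2) := by rw [show m + 1 = j + 2 by omega]
    split_ifs <;> first | (exfalso; omega) | ring
  split_ifs <;> first | (exfalso; omega) | ring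

/-- `sum_swapDelta_two` (docstring added by the landing lane; see the module docstring). [formal bookkeeping] -/
theorem sum_swapDelta_two (hs : IsHaggSeq s)
    (hrun5 : s (j - 2) = s (j - 1) ∧ s (j - 1) = s j ∧ s j = s (j + 1) ∧ s (j + 1) = s (j + 2)) (J : ℕ → ℝ) {M : ℕ} (hM : 2 ≤ M) :
    ∑ m ∈ Finset.Icc (j - M) (j + M), swapDelta J j s m 2 = 2 * J 2 := by
  rw [Finset.sum_congr rfl fun m _ => swapDelta_two_eq hs hrun5 J m, Finset.sum_ite_mem]
  have hM' : (2 : ℤ) ≤ (M : ℤ) := by exact_mod_cast hM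
  have hsub : ({j - 2, j + 1} : Finset ℤ) ⊆ Finset.Icc (j - M) (j + M) := by
    intro x hx
    simp only [Finset.mem_insert, Finset.mem_singleton] at hx
    simp only [Finset.mem_Icc]
    omega
  rw [Finset.inter_eq_right.2 hsub, Finset.sum_insert, Finset.sum_singleton]
  · ring
  all_goals simp only [Finset.mem_singleton]; omega

/-- ★ **THE SWAP COLUMN INEQUALITY (word level)**: for a Hägg word with five equal steps `s(j−2) = ⋯ = s(j+2)` (letters `c` on layers `j−1 … j+2`),
`∑_{|m−j| ≤ M} [E_K(swapFlip j s)(m) − E_K(s)(m)] ≤ 2·J 2 + 4·∑_{k=3}^{K} |J k|` (`K ≥ 2`, `M ≥ 2`) — the shape of `IdealTwinGain`. [this file · kind: proof] -/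
theorem swap_localEnergyTrunc_le (hs : IsHaggSeq s)
    (hrun5 : s (j - 2) = s (j - 1) ∧ s (j - 1) = s j ∧ s j = s (j + 1) ∧ s (j + 1) = s (j + 2))
    (J : ℕ → ℝ) {K M : ℕ} (hK : 2 ≤ K) (hM : 2 ≤ M) :
    ∑ m ∈ Finset.Icc (j - M) (j + M), (haggLocalEnergyTrunc K J (swapFlip j s) m - haggLocalEnergyTrunc K J s m)
      ≤ 2 * J 2 + 4 * ∑ k ∈ Finset.Icc 3 K, |J k| := by
  have hrun : s (j - 1) = s j ∧ s j = s (j + 1) := ⟨by omega, by omega⟩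
  have e1 : ∀ m, haggLocalEnergyTrunc K J (swapFlip j s) m - haggLocalEnergyTrunc K J s m
      = ∑ k ∈ Finset.Icc 2 K, swapDelta J j s m k := by
    intro m
    simp only [haggLocalEnergyTrunc, swapDelta, Finset.sum_sub_distrib]
  rw [Finset.sum_congr rfl fun m _ => e1 m, Finset.sum_comm]
  have hI : Finset.Icc 2 K = insert 2 (Finset.Icc 3 K) := by
    ext k
    simp only [Finset.mem_Icc, Finset.mem_insert]
    omega
  rw [hI, Finset.sum_insert (by simp), sum_swapDelta_two hs hrun5 J hM, Finset.mul_sum]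
  have hsum : ∑ k ∈ Finset.Icc 3 K, ∑ m ∈ Finset.Icc (j - M) (j + M), swapDelta J j s m k
      ≤ ∑ k ∈ Finset.Icc 3 K, 4 * |J k| :=
    Finset.sum_le_sum fun k hk => by
      have hk3 : 3 ≤ k := (Finset.mem_Icc.1 hk).1
      exact (le_abs_self _).trans (abs_sum_swapDelta_le hrun (by omega) _)
  linarith [hsum]

end Summit.AtomisticToContinuum.Crystallization.Theorems.OverbindingBudgetAffineRunCutWord

end
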